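import Summits.CriticalPhenomena.CardyFormulaZ2.Theorems.CardyFlipRussoVoronoiHubFromSmirnovOneArmEvents
import Summits.CriticalPhenomena.CardyFormulaZ2.Theorems.CardyFlipRussoVoronoiHubFromSmirnovNavelTie
import Summits.CriticalPhenomena.CardyFormulaZ2.Theorems.CardyFlipRussoVoronoiHubFromSmirnovClosePair
import Summits.CriticalPhenomena.CardyFormulaZ2.Theorems.CardyFlipRussoVoronoiHubFromSmirnovUnionLaw
import Summits.CriticalPhenomena.CardyFormulaZ2.Theorems.CardyFlipRussoVoronoiHubFromSmirnovTransportCoupling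
import Literature.Analysis.FunctionSpaces.PoissonMappingRestricted
import Literature.Analysis.FunctionSpaces.PoissonPointProcessProofs
import Mathlib.MeasureTheory.Function.Jacobian

/-!
# Stubs `potDef_bound_hom`, `potDef_bound_transport` of line `moebius-exact-delaunay-dilation-ward`
# (crux `VoronoiHubFromSmirnov`, stmt-CriticalPhenomena-6433)

Probability bounds for the two POTENTIAL-DEFECT events `NearTie` / `ClosePair` (module
`…OneArmEvents`; I. Benjamini, O. Schramm, *Conformal invariance of Voronoi percolation*,
Comm. Math. Phys. 197 (1998) 75–107, Lemma 4.2 and Thm 5.6) near an arbitrary centre `z`, for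
* (hom) ALL the nuclei `c.1 ∪ c.2` of the homogeneous two-colour law `lawBW volume` — a Poisson
  process of intensity `2 · Lebesgue` (Kingman's Superposition Theorem `superposition_holds`);
* (transport) the IMAGES `T '' ((c.1 ∪ c.2) ∩ W)` of the windowed nuclei, `W = {b | δ b ∈ B}`, under
  the transport map `T = transportMap g δ` (`b ↦ g (δ b) / δ`) of an expanding (`‖g′‖ ≥ m` on `B`)
  map `g` injective on the bounded measurable set `B` — a Poisson process of intensity
  `ν = ((2 · Leb)|_W) ∘ T⁻¹` (restricted Mapping Theorem `IsPoissonPointProcess.map_imageRestrict`)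
  with `ν ≤ (2 / m²) · Lebesgue` by the area formula
  (`MeasureTheory.lintegral_abs_det_fderiv_le_addHaar_image`: `m² |A| ≤ ∫_A |det DT| ≤ |T A|`, the
  real Jacobian of `T` at `b` being `‖g′(δ b)‖²`, `det_restrictScalars_smulRight`).

In both cases the event at centre `z` is carried to the event at centre `0` by the translation
`PointConfig.translate (-z)`, which maps a Poisson process of intensity `μ ≤ M₀ · Leb` to a Poisson
process of intensity `μ ∘ (· - z)⁻¹ ≤ M₀ · Leb` (Mapping Theorem for translations `translate_holds`,
translation invariance of Lebesgue measure `measure_preimage_add_right`), and the landed bounds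
`poisson_navelTie_le` / `poisson_closePair_le` apply with `M₀ = 2`, resp. `M₀ = 2 / m²`.  Passing
from the probability of a preimage event to the image law never needs measurability of the event
(`Measure.le_map_apply`).

References: Benjamini–Schramm 1998, Lemma 4.2, Thm 5.6; J. F. C. Kingman, *Poisson Processes*
(OUP 1993), §2.2 Superposition and Restriction Theorems, §2.3 Mapping Theorem.
No new definitions; tree facts and Mathlib only.
-/

noncomputable section

namespace Summit.CriticalPhenomena.CardyFormulaZ2.Cruxes.VoronoiHubFromSmirnov.MoebiusExactDelaunayDilationWard

open scoped ENNReal Topology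
open MeasureTheory Set Metric Literature.Analysis.FunctionSpaces

/-! ### Generic measure-theoretic glue -/

/-- The probability of a preimage event is at most the probability of the event under the image
law (no measurability of the event needed; `Measure.le_map_apply`), in `Measure.real` form for a
finite measure. -/
theorem pdb_measureReal_preimage_le_map {α β : Type*} [MeasurableSpace α] [MeasurableSpace β]
    {μ : Measure α} [IsFiniteMeasure μ] {f : α → β} (hf : AEMeasurable f μ) (s : Set β) :
    μ.real (f ⁻¹' s) ≤ (μ.map f).real s := by
  rw [measureReal_def, measureReal_def]
  exact ENNReal.toReal_mono (measure_ne_top _ _) (Measure.le_map_apply hf s)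

/-- An intensity dominated by `M₀ · Lebesgue` stays dominated by `M₀ · Lebesgue` after a
translation (translation invariance of Lebesgue measure on `ℂ`). -/
theorem pdb_map_translate_le {μ : Measure ℂ} {M₀ : ℝ}
    (hμ : ∀ S : Set ℂ, MeasurableSet S → μ S ≤ ENNReal.ofReal M₀ * volume S) (v : ℂ) :
    ∀ S : Set ℂ, MeasurableSet S → (μ.map (· + v)) S ≤ ENNReal.ofReal M₀ * volume S := by
  intro S hS
  rw [Measure.map_apply (measurable_add_const v) hS]
  calc μ ((· + v) ⁻¹' S) ≤ ENNReal.ofReal M₀ * volume ((· + v) ⁻¹' S) :=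
        hμ _ (measurable_add_const v hS)
    _ = ENNReal.ofReal M₀ * volume S := by rw [measure_preimage_add_right]

/-! ### Re-centring: the events at centre `z` translate to the landed events at centre `0` -/

/-- A near-tied navel near `z` of the nuclei of `d` is, after translating by `-z`, a near-tied
navel near `0` of the translated configuration (the event of `poisson_navelTie_le`). -/
theorem pdb_nearTie_translate {d : PointConfig ℂ} {z : ℂ} {ρ ℓ τ : ℝ}
    (h : NearTie (d : Set ℂ) z ρ ℓ τ) :
    PointConfig.translate (-z) d ∈ {c : PointConfig ℂ | ∃ (x p q a b : ℂ), p ∈ c ∧ q ∈ c ∧ a ∈ c ∧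
      b ∈ c ∧ p ≠ q ∧ a ≠ b ∧ a ≠ p ∧ a ≠ q ∧ b ≠ p ∧ b ≠ q ∧ x ∈ Metric.closedBall (0 : ℂ) ρ ∧
      dist p x = dist q x ∧ dist p x ≤ ℓ ∧ dist a x = dist b x ∧ dist p x ≤ dist a x ∧
      dist a x < dist p x + τ} := by
  obtain ⟨x, p, q, a, b, hp, hq, ha, hb, h1, h2, h3, h4, h5, h6, hx, h7, h8, h9, h10, h11⟩ := h
  have hmem : ∀ {y : ℂ}, y ∈ (d : Set ℂ) → y + -z ∈ PointConfig.translate (-z) d :=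
    fun {y} hy => ⟨y, hy, rfl⟩
  have hne : ∀ {u w : ℂ}, u ≠ w → u + -z ≠ w + -z := fun huw h => huw (add_right_cancel h)
  refine ⟨x + -z, p + -z, q + -z, a + -z, b + -z, hmem hp, hmem hq, hmem ha, hmem hb, hne h1,
    hne h2, hne h3, hne h4, hne h5, hne h6, ?_, ?_, ?_, ?_, ?_, ?_⟩
  · rw [mem_closedBall, dist_zero_right, ← sub_eq_add_neg, ← dist_eq_norm]
    exact hx
  all_goals simp only [dist_add_right]
  exacts [h7, h8, h9, h10, h11]

/-- A close pair near `z` of the nuclei of `d` is, after translating by `-z`, a close pair near `0`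
of the translated configuration (the event of `poisson_closePair_le`). -/
theorem pdb_closePair_translate {d : PointConfig ℂ} {z : ℂ} {ρ τ : ℝ}
    (h : ClosePair (d : Set ℂ) z ρ τ) :
    PointConfig.translate (-z) d ∈ {c : PointConfig ℂ | ∃ a ∈ c, ∃ b ∈ c, a ≠ b ∧
      a ∈ Metric.closedBall (0 : ℂ) ρ ∧ dist a b < τ} := by
  obtain ⟨a, ha, b, hb, hab, haz, hd⟩ := h
  have hmem : ∀ {y : ℂ}, y ∈ (d : Set ℂ) → y + -z ∈ PointConfig.translate (-z) d :=
    fun {y} hy => ⟨y, hy, rfl⟩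
  refine ⟨a + -z, hmem ha, b + -z, hmem hb, fun h => hab (add_right_cancel h), ?_, ?_⟩
  · rw [mem_closedBall, dist_zero_right, ← sub_eq_add_neg, ← dist_eq_norm]
    exact haz
  · rw [dist_add_right]
    exact hd

/-! ### The bounds at an arbitrary centre, for any Poisson process of bounded intensity -/

/-- `poisson_navelTie_le` re-centred at `z`: for a Poisson process of intensity `≤ M₀ · Leb`,
`P(NearTie near z) ≤ (4ρ/τ + 1)² · (4ℓ/τ) · (36 π M₀ τ ℓ)⁴ / 24` (translate by `-z`). -/
theorem pdb_nearTie_le {μ : Measure ℂ} {Q : Measure (PointConfig ℂ)} (M₀ : ℝ)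
    (hQ : IsPoissonPointProcess μ Q) (hM₀ : 0 ≤ M₀)
    (hμ : ∀ S : Set ℂ, MeasurableSet S → μ S ≤ ENNReal.ofReal M₀ * volume S) (z : ℂ)
    {ρ ℓ τ : ℝ} (hτ : 0 < τ) (hτℓ : τ ≤ ℓ) (hℓρ : ℓ ≤ ρ) :
    Q.real {d | NearTie (d : Set ℂ) z ρ ℓ τ} ≤
      (4 * ρ / τ + 1) ^ 2 * (4 * ℓ / τ) * ((36 * Real.pi * M₀ * τ * ℓ) ^ 4 / 24) := by
  haveI := hQ.isProbabilityMeasure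
  have hT := IsPoissonPointProcess.translate_holds hQ (-z)
  have hb := poisson_navelTie_le M₀ hT hM₀ (pdb_map_translate_le hμ (-z)) ρ ℓ τ hτ hτℓ hℓρ
  refine le_trans ?_ ((pdb_measureReal_preimage_le_map
    (PointConfig.measurable_translate (-z)).aemeasurable _).trans hb)
  exact measureReal_mono (fun d hd => pdb_nearTie_translate hd) (measure_ne_top _ _)

/-- `poisson_closePair_le` re-centred at `z`: for a Poisson process of intensity `≤ M₀ · Leb`,
`P(ClosePair near z) ≤ (4ρ/τ + 1)² · (M₀ π (2τ)²)² / 2` (translate by `-z`). -/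
theorem pdb_closePair_le {μ : Measure ℂ} {Q : Measure (PointConfig ℂ)} (M₀ : ℝ)
    (hQ : IsPoissonPointProcess μ Q) (hM₀ : 0 ≤ M₀)
    (hμ : ∀ S : Set ℂ, MeasurableSet S → μ S ≤ ENNReal.ofReal M₀ * volume S) (z : ℂ)
    {ρ τ : ℝ} (hτ : 0 < τ) (hτρ : τ ≤ ρ) :
    Q.real {d | ClosePair (d : Set ℂ) z ρ τ} ≤
      (4 * ρ / τ + 1) ^ 2 * ((M₀ * Real.pi * (2 * τ) ^ 2) ^ 2 / 2) := by
  haveI := hQ.isProbabilityMeasure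
  have hT := IsPoissonPointProcess.translate_holds hQ (-z)
  have hb := poisson_closePair_le M₀ hT hM₀ (pdb_map_translate_le hμ (-z)) ρ τ hτ hτρ
  refine le_trans ?_ ((pdb_measureReal_preimage_le_map
    (PointConfig.measurable_translate (-z)).aemeasurable _).trans hb)
  exact measureReal_mono (fun d hd => pdb_closePair_translate hd) (measure_ne_top _ _)

/-! ### The union process of `lawBW volume` -/

/-- ALL the nuclei of `lawBW volume` form a Poisson process of intensity `Leb + Leb`
(Kingman's Superposition Theorem). -/
theorem pdb_isPoissonPointProcess_union :
    IsPoissonPointProcess ((volume : Measure ℂ) + volume)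
      ((lawBW (volume : Measure ℂ)).map fun c : PointConfig ℂ × PointConfig ℂ => c.1 ∪ c.2) :=
  IsPoissonPointProcess.superposition_holds isPoissonPointProcess_poissonLaw_volume
    isPoissonPointProcess_poissonLaw_volume

/-- The doubled Lebesgue intensity is dominated by `2 · Lebesgue`. -/
theorem pdb_volume_add_volume_le : ∀ S : Set ℂ, MeasurableSet S →
    ((volume : Measure ℂ) + volume : Measure ℂ) S ≤ ENNReal.ofReal 2 * volume S := by
  intro S _
  rw [Measure.add_apply, ENNReal.ofReal_ofNat, two_mul]

/-- **Stub `potDef_bound_hom`**: potential defects near any centre `z` are rare for the nuclei of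
the homogeneous two-colour law (`M₀ = 2`). -/
theorem potDef_bound_hom : ∀ (z : ℂ) (ρ ℓ τ : ℝ), 0 < τ → τ ≤ ℓ → ℓ ≤ ρ → (lawBW (MeasureTheory.volume : MeasureTheory.Measure ℂ)).real {c | NearTie ((c.1 : Set ℂ) ∪ (c.2 : Set ℂ)) z ρ ℓ τ} ≤ (4 * ρ / τ + 1) ^ 2 * (4 * ℓ / τ) * ((36 * Real.pi * 2 * τ * ℓ) ^ 4 / 24) ∧ (lawBW (MeasureTheory.volume : MeasureTheory.Measure ℂ)).real {c | ClosePair ((c.1 : Set ℂ) ∪ (c.2 : Set ℂ)) z ρ τ} ≤ (4 * ρ / τ + 1) ^ 2 * ((2 * Real.pi * (2 * τ) ^ 2) ^ 2 / 2) := by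
  intro z ρ ℓ τ hτ hτℓ hℓρ
  haveI := isProbabilityMeasure_lawBW_volume
  have hU : Measurable fun c : PointConfig ℂ × PointConfig ℂ => c.1 ∪ c.2 :=
    PointConfig.measurable_union'
  have hQ := pdb_isPoissonPointProcess_union
  refine ⟨?_, ?_⟩
  · exact (pdb_measureReal_preimage_le_map hU.aemeasurable
      {d : PointConfig ℂ | NearTie (d : Set ℂ) z ρ ℓ τ}).trans
      (pdb_nearTie_le 2 hQ (by norm_num) pdb_volume_add_volume_le z hτ hτℓ hℓρ)
  · exact (pdb_measureReal_preimage_le_map hU.aemeasurable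
      {d : PointConfig ℂ | ClosePair (d : Set ℂ) z ρ τ}).trans
      (pdb_closePair_le 2 hQ (by norm_num) pdb_volume_add_volume_le z hτ (hτℓ.trans hℓρ))

/-! ### The transport map: derivative and area expansion -/

/-- Chain rule for the transport map `b ↦ g (δ b) / δ`: its complex derivative at `b` is the
derivative of `g` at `δ b`. -/
theorem pdb_hasDerivAt_transportMap {g : ℂ → ℂ} {c : ℂ} {δ : ℝ} (hδ : (δ : ℂ) ≠ 0) {b : ℂ}
    (h : HasDerivAt g c ((δ : ℂ) * b)) : HasDerivAt (transportMap g δ) c b := by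
  have h2 : HasDerivAt (fun b : ℂ => (δ : ℂ) * b) ((δ : ℂ) * 1) b :=
    (hasDerivAt_id b).const_mul (δ : ℂ)
  have h3 := (h.comp b h2).div_const (δ : ℂ)
  have h4 : c * ((δ : ℂ) * 1) / (δ : ℂ) = c := by field_simp
  rw [h4] at h3
  exact h3

/-- **Area expansion.** If `g` has derivative of norm `≥ m > 0` on `B` and is injective on `B`,
then for every measurable `A ⊆ {b | δ b ∈ B}` (`δ ≠ 0`) the transport map `T = transportMap g δ`
satisfies `m² · |A| ≤ |T '' A|`: the real Jacobian determinant of `T` at `b` is `‖g′(δ b)‖² ≥ m²`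
(`det_restrictScalars_smulRight`) and `∫_A |det DT| ≤ |T '' A|`
(`lintegral_abs_det_fderiv_le_addHaar_image`). -/
theorem pdb_volume_image_ge {g g' : ℂ → ℂ} {B : Set ℂ} {m δ : ℝ} (hm : 0 < m) (hδ : δ ≠ 0)
    (hder : ∀ x ∈ B, HasDerivAt g (g' x) x) (hm' : ∀ x ∈ B, m ≤ ‖g' x‖) (hinj : Set.InjOn g B)
    {A : Set ℂ} (hA : MeasurableSet A) (hAW : A ⊆ {b : ℂ | (δ : ℂ) * b ∈ B}) :
    ENNReal.ofReal (m ^ 2) * volume A ≤ volume (transportMap g δ '' A) := by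
  have hδ' : (δ : ℂ) ≠ 0 := Complex.ofReal_ne_zero.2 hδ
  have hf' : ∀ b ∈ A, HasFDerivWithinAt (transportMap g δ)
      ((ContinuousLinearMap.smulRight (1 : ℂ →L[ℂ] ℂ) (g' ((δ : ℂ) * b))).restrictScalars ℝ)
      A b := fun b hb =>
    ((pdb_hasDerivAt_transportMap hδ' (hder _ (hAW hb))).hasFDerivAt.restrictScalars
      ℝ).hasFDerivWithinAt
  have hinjA : InjOn (transportMap g δ) A := (injOn_transportMap hinj hδ).mono hAW
  calc ENNReal.ofReal (m ^ 2) * volume A = ∫⁻ _ in A, ENNReal.ofReal (m ^ 2) ∂volume :=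
        (setLIntegral_const A _).symm
    _ ≤ ∫⁻ b in A, ENNReal.ofReal |(((ContinuousLinearMap.smulRight (1 : ℂ →L[ℂ] ℂ)
          (g' ((δ : ℂ) * b))).restrictScalars ℝ)).det| ∂volume := by
        refine setLIntegral_mono' hA fun b hb => ?_
        rw [Literature.Analysis.Complex.LengthArea.det_restrictScalars_smulRight,
          abs_of_nonneg (by positivity)]
        exact ENNReal.ofReal_le_ofReal (pow_le_pow_left₀ hm.le (hm' _ (hAW hb)) 2)
    _ ≤ volume (transportMap g δ '' A) :=
        lintegral_abs_det_fderiv_le_addHaar_image volume hA hf' hinjA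

/-- **Intensity of the transported union process.** The push-forward `((Leb + Leb)|_W).map T`
of the doubled Lebesgue intensity of the window `W = {b | δ b ∈ B}` under the expanding injective
transport map is dominated by `(2 / m²) · Lebesgue`. -/
theorem pdb_transport_intensity_le {g g' : ℂ → ℂ} {B : Set ℂ} {m δ : ℝ} (hg : Measurable g)
    (hB : MeasurableSet B) (hm : 0 < m) (hδ : δ ≠ 0) (hder : ∀ x ∈ B, HasDerivAt g (g' x) x)
    (hm' : ∀ x ∈ B, m ≤ ‖g' x‖) (hinj : Set.InjOn g B) :
    ∀ S : Set ℂ, MeasurableSet S →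
      ((((volume : Measure ℂ) + volume).restrict {b : ℂ | (δ : ℂ) * b ∈ B}).map
        (transportMap g δ)) S ≤ ENNReal.ofReal (2 / m ^ 2) * volume S := by
  intro S hS
  have hTm : Measurable (transportMap g δ) := measurable_transportMap hg δ
  have hWm : MeasurableSet {b : ℂ | (δ : ℂ) * b ∈ B} := measurable_const_mul (δ : ℂ) hB
  set A : Set ℂ := transportMap g δ ⁻¹' S ∩ {b : ℂ | (δ : ℂ) * b ∈ B} with hA
  have hAm : MeasurableSet A := (hTm hS).inter hWm
  have hle : ENNReal.ofReal (m ^ 2) * volume A ≤ volume S :=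
    (pdb_volume_image_ge hm hδ hder hm' hinj hAm inter_subset_right).trans
      (measure_mono (image_subset_iff.2 fun b hb => hb.1))
  have hm2 : 0 < m ^ 2 := by positivity
  have hc0 : ENNReal.ofReal (m ^ 2) ≠ 0 := (ENNReal.ofReal_pos.2 hm2).ne'
  have hA' : volume A ≤ (ENNReal.ofReal (m ^ 2))⁻¹ * volume S := by
    calc volume A = (ENNReal.ofReal (m ^ 2))⁻¹ * (ENNReal.ofReal (m ^ 2) * volume A) := by
          rw [← mul_assoc, ENNReal.inv_mul_cancel hc0 ENNReal.ofReal_ne_top, one_mul]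
      _ ≤ (ENNReal.ofReal (m ^ 2))⁻¹ * volume S := mul_le_mul_right hle _
  rw [Measure.map_apply hTm hS, Measure.restrict_apply (hTm hS), Measure.add_apply, ← hA,
    ← two_mul]
  calc 2 * volume A ≤ 2 * ((ENNReal.ofReal (m ^ 2))⁻¹ * volume S) := mul_le_mul_right hA' _
    _ = ENNReal.ofReal (2 / m ^ 2) * volume S := by
        rw [← mul_assoc, div_eq_mul_inv, ENNReal.ofReal_mul (by norm_num : (0 : ℝ) ≤ 2),
          ENNReal.ofReal_ofNat, ENNReal.ofReal_inv_of_pos hm2]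

/-! ### Stub `potDef_bound_transport` -/

/-- **Stub `potDef_bound_transport`**: potential defects near any centre `z` are rare for the
transported windowed nuclei `T '' ((c.1 ∪ c.2) ∩ W)` (a Poisson process of intensity
`≤ (2 / m²) · Leb` by the restricted Mapping Theorem and the area expansion of `T`). -/
theorem potDef_bound_transport : ∀ (g g' : ℂ → ℂ) (B : Set ℂ) (m δ : ℝ) (z : ℂ) (ρ ℓ τ : ℝ), Measurable g → MeasurableSet B → Bornology.IsBounded B → 0 < m → 0 < δ → (∀ x ∈ B, HasDerivAt g (g' x) x) → (∀ x ∈ B, m ≤ ‖g' x‖) → Set.InjOn g B → 0 < τ → τ ≤ ℓ → ℓ ≤ ρ → (lawBW (MeasureTheory.volume : MeasureTheory.Measure ℂ)).real {c | NearTie (transportMap g δ '' ((((c.1 : Set ℂ) ∪ (c.2 : Set ℂ)) ∩ {b : ℂ | (δ : ℂ) * b ∈ B}))) z ρ ℓ τ} ≤ (4 * ρ / τ + 1) ^ 2 * (4 * ℓ / τ) * ((36 * Real.pi * (2 / m ^ 2) * τ * ℓ) ^ 4 / 24) ∧ (lawBW (MeasureTheory.volume : MeasureTheory.Measure ℂ)).real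 {c | ClosePair (transportMap g δ '' ((((c.1 : Set ℂ) ∪ (c.2 : Set ℂ)) ∩ {b : ℂ | (δ : ℂ) * b ∈ B}))) z ρ τ} ≤ (4 * ρ / τ + 1) ^ 2 * (((2 / m ^ 2) * Real.pi * (2 * τ) ^ 2) ^ 2 / 2) := by
  intro g g' B m δ z ρ ℓ τ hg hB hBb hm hδ hder hm' hinj hτ hτℓ hℓρ
  haveI := isProbabilityMeasure_lawBW_volume
  obtain ⟨K, hK, hWK⟩ := exists_isCompact_window hBb hδ
  have hWm : MeasurableSet {b : ℂ | (δ : ℂ) * b ∈ B} := measurable_const_mul (δ : ℂ) hB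
  have hTm : Measurable (transportMap g δ) := measurable_transportMap hg δ
  have hTinj : InjOn (transportMap g δ) {b : ℂ | (δ : ℂ) * b ∈ B} := injOn_transportMap hinj hδ.ne'
  have hU : Measurable fun c : PointConfig ℂ × PointConfig ℂ => c.1 ∪ c.2 :=
    PointConfig.measurable_union'
  have hΦ : Measurable (PointConfig.imageRestrict (transportMap g δ) {b : ℂ | (δ : ℂ) * b ∈ B} :
      PointConfig ℂ → PointConfig ℂ) :=
    PointConfig.measurable_imageRestrict hK hWK hWm hTm hTinj
  have hQ := pdb_isPoissonPointProcess_union.map_imageRestrict hTm hK hWK hWm hTinj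
  have hν := pdb_transport_intensity_le hg hB hm hδ.ne' hder hm' hinj
  have hM₀ : (0 : ℝ) ≤ 2 / m ^ 2 := by positivity
  -- the event read on the image configuration
  have hcoe : ∀ c : PointConfig ℂ × PointConfig ℂ,
      ((PointConfig.imageRestrict (transportMap g δ) {b : ℂ | (δ : ℂ) * b ∈ B} (c.1 ∪ c.2) :
        PointConfig ℂ) : Set ℂ) =
        transportMap g δ '' ((((c.1 : Set ℂ) ∪ (c.2 : Set ℂ)) ∩ {b : ℂ | (δ : ℂ) * b ∈ B})) :=
    fun c => PointConfig.coe_imageRestrict hK hWK _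
  refine ⟨?_, ?_⟩
  · have h1 := pdb_nearTie_le (2 / m ^ 2) hQ hM₀ hν z hτ hτℓ hℓρ
    have h2 := (pdb_measureReal_preimage_le_map hU.aemeasurable _).trans
      ((pdb_measureReal_preimage_le_map hΦ.aemeasurable _).trans h1)
    refine le_trans (le_of_eq ?_) h2
    congr 1
    ext c
    simp only [mem_setOf_eq, mem_preimage, hcoe]
  · have h1 := pdb_closePair_le (2 / m ^ 2) hQ hM₀ hν z hτ (hτℓ.trans hℓρ)
    have h2 := (pdb_measureReal_preimage_le_map hU.aemeasurable _).trans
      ((pdb_measureReal_preimage_le_map hΦ.aemeasurable _).trans h1)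
    refine le_trans (le_of_eq ?_) h2
    congr 1
    ext c
    simp only [mem_setOf_eq, mem_preimage, hcoe]

end Summit.CriticalPhenomena.CardyFormulaZ2.Cruxes.VoronoiHubFromSmirnov.MoebiusExactDelaunayDilationWard

end
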